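/-
Copyright: the b2b-balaban T⁴-continuum CRUX team, row NE7b leaf lineage `t4-ne7b-formalise-leaf-06` (gen 158). Project licence.
-/
import Summits.QuantumFields.BalabanUV.T4Continuum.Spine.NE7b.OneShotChartFourier

/-!
# PALEY–WIENER IN THE BLOCK-MOMENTUM FIBRE: the coordinate contour-shift IDENTITY `K_{G(·+iσe_i)}(x) = e^{σx_i}·K_G(x)` for a
# strip-regular multiplier, the WEIGHTED BESSEL inequality `Σ_x‖K_G(x)‖²e^{2σx_i} ≤ (2π)^{−(d+1)}∫‖G(p+iσe_i)‖²dp ≤ M²`, and the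
# Cauchy–Schwarz TAIL ⇒ the PARAMETRIC `ℓ¹`-row letter `Σ_{x∈T}‖K_G(x)‖ ≤ NF(r₀) + √(Σ_{|x|_∞>r₀}e^{−2q|x|_∞})·√(2(d+1))·M`
# (row NE7b, node U5c; T-109's (CT-2) BY NAME; Mathlib + the tree's `B4ContourShift` ∕ `B4Eq246SquareSummable`; [folklore])

Cell `pub-balaban`, sub-cell `t4`, spine estimate NE7b (`T4WeightBudget.RelWeightBound`; the cell's OWN estimate — NOT PRINTED in
[Bałaban 1983–89], NOT PROVED).  Crux-route work under `Spine/NE7b/` by leaf-06 (CRUX team (2), FREEZE (0) crux-prover clause).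
NOTHING of Bałaban's is named as a Lean object, valued or asserted; no `T4Continuum/Support` leaf typed; no `def`; zero `sorry`.
Import: the OWNER's (41) `…OneShotChartFourier` (for its import cone `B4ContourShift` ∕ `B4Eq246SquareSummable` ∕ `B4Strip` and the
helper `integrableOn_integrand_of_continuousOn`; nothing of the one-shot section itself is used — every theorem here is about an ARBITRARY
strip-regular multiplier `G`, the one-shot multiplier `G_τ∕symbQGQ` being strip-regular by the companion `…OneShotChartStrip`).

WHY.  idea-1 g109's T-109 (`t4/ideate/NE7b/checks-g109/T109-…md` §4–§5) prices the device print NAMES for the sup-currency chart letter of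
the one-shot section (NL-NE7b-1, PRICING-NE7b v121 F721) — Combes–Thomas ∕ Paley–Wiener in the block-momentum fibre — and finds it the only
road that passes by value at `M = 8, 16` (`d = 4`); its proof shape is (CT-1) a zero-free strip (companion file), (CT-2) «Paley–Wiener +
Cauchy–Schwarz tail (bookkeeping + d-dimensional Parseval — typing)», (CT-3) a certified near field (calc), (CT-4) torus ≤ `ℤ^d`.  THIS FILE
is (CT-2): for a strip-regular multiplier the lattice kernel's weighted `ℓ²` norms `I_i(σ) = Σ_x‖K(x)‖²e^{2σx_i}` are shifted-contour
Bessel integrals, hence `≤ M²`, and the `ℓ¹` row norm splits into a finite NEAR FIELD plus a tail controlled by `√(Σe^{−2q|x|_∞})·W(q)`,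
`W(q)² ≤ Σ_i(I_i(q) + I_i(−q))` — T-109 §4.1's letter VERBATIM, with the near field and the `I_i(±q)` DISPLAYED for balaban-calc.

WHAT IS PROVED (`G : ℂ^{d+1} → ℂ`, `StripRegular G κ M` (`B4ContourShift`), `|σ| ≤ κ`, `i` a coordinate, `K = latticeKernel G`; all [folklore]):
* §1 `update_ofRealVec_mem_Strip`, `continuousOn_imShift`, `integrableOn_integrand_imShift` (the shifted multiplier `p ↦ G(p + iσe_i)` is
  continuous on the real zone); **`fourierBox_imShift`** ∕ **`latticeKernel_imShift`**: `K_{G(·+iσe_i)}(x) = e^{σx_i}·K_G(x)` — the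
  contour-shift IDENTITY in one coordinate (`B4ContourShift.integral_shift` slice by slice under `fourierBox_eq_iterated`).
* §2 **`sum_normSq_latticeKernel_exp_le_integral`** (`Σ_{x∈T}‖K(x)‖²e^{2σx_i} ≤ (2π)^{−(d+1)}∫_{BZ}‖G(p+iσe_i)‖²dp` — WEIGHTED BESSEL, the
  integral DISPLAYED), **`sum_normSq_latticeKernel_exp_le`** (`≤ M²`).
* §3 `exp_mul_supNorm_le_sum` (`e^{2q|x|_∞} ≤ Σ_i(e^{2qx_i} + e^{−2qx_i})`), **`sum_normSq_latticeKernel_expSup_le`**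
  (`W_T(q)² := Σ_{x∈T}‖K(x)‖²e^{2q|x|_∞} ≤ 2(d+1)M²` for `0 ≤ q ≤ κ`).
* §4 **`sum_norm_le_sqrt_mul_sqrt`** (Cauchy–Schwarz tail: `Σ_{x∈S}‖K(x)‖ ≤ √(Σ_{x∈S}e^{−2q|x|_∞})·√(Σ_{x∈S}‖K(x)‖²e^{2q|x|_∞})`).
* §5 **`row_letter_parametric`**: for every finite window `T` and radius `r₀`,
  `Σ_{x∈T}‖K(x)‖ ≤ Σ_{x∈T,|x|_∞≤r₀}‖K(x)‖ + √(Σ_{x∈T,|x|_∞>r₀}e^{−2q|x|_∞})·√(Σ_{x∈T,|x|_∞>r₀}‖K(x)‖²e^{2q|x|_∞})` and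
  **`row_letter`**: `… ≤ NF_T(r₀) + √(Σ_{x∈T,|x|_∞>r₀}e^{−2q|x|_∞})·√(2(d+1))·M` — the `ℓ¹` ROW LETTER of a strip-regular multiplier with the
  near field and the tail count displayed (the near field `NF` and sharper `I_i(±q)` are (CT-3), balaban-calc's; the tail count is a lattice sum
  `≤ latticeConst`-type closed forms, not evaluated here).

HONEST BY VALUE: with the companion's crude `κ` the tail factor is useless at every `M` of record; the file's value is the SHAPE (CT-2) in the
kernel, into which certified `(q, W, NF)` can be substituted.  Nothing of (A3) ∕ NC-NE7b-α; the identification with the torus section is not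
here.  BY-NAME EFFECT ON THE WALL: NONE.  NE7b NOT PRINTED ∕ NOT PROVED; spine PROVED 0∕9; rung (B)+1 on a FINITE torus — NOT infinite
volume, NOT the mass gap, NOT Clay.  HONEST DEPENDENCY: continuum YM on T⁴ ⇐ BetaPertH ∧ nine spine estimates (0∕9 proved); BetaPertH ⇐
(D1) ∧ (D4) ∧ CAP+tail; G-an2-4 gates asym, D1 and NE2∕3∕4.
-/

set_option autoImplicit false

namespace Summit.QuantumFields.BalabanUV.T4Continuum.NE7b.OneShotChartPaleyWiener

open Complex Finset MeasureTheory Set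
open Literature.MathematicalPhysics.QuantumFieldTheory.Balaban1983to89
open B4Strip (Strip ofRealVec)
open B4ContourShift (StripRegular latticeKernel fourierBox integrand phase BZ supNorm abs_le_supNorm supNorm_nonneg
  exists_supNorm_eq closedRect openRect integral_shift side_char fourierBox_eq_iterated ofRealVec_insertNth phase_insertNth
  norm_cexp_phase insertNth_mem_Strip ofRealVec_mem_Strip continuous_ofRealVec)
open B4Eq246SquareSummable (sum_normSq_latticeKernel_le)
open OneShotChartFourier (integrableOn_integrand_of_continuousOn)
open scoped Real

variable {d : ℕ}

/-! ## §1. The shifted multiplier and the contour-shift identity -/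

/-- the point `Re p ∈ [−π,π]^{d+1}` moved to height `σ` in the coordinate `i` lies in the strip of half-width `κ ≥ |σ|`. [folklore] -/
theorem update_ofRealVec_mem_Strip {κ σ : ℝ} (hσ : |σ| ≤ κ) (i : Fin (d + 1)) {p : Fin (d + 1) → ℝ} (hp : p ∈ BZ (d + 1)) :
    Function.update (ofRealVec p) i ((p i : ℂ) + σ * I) ∈ Strip (d + 1) κ := by
  have hκ : 0 ≤ κ := (abs_nonneg σ).trans hσ
  intro j
  by_cases hj : j = i
  · subst hj
    rw [Function.update_self]
    refine ⟨?_, ?_⟩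
    · simpa using abs_le.mpr ⟨hp.1 j, hp.2 j⟩
    · simpa using hσ
  · rw [Function.update_of_ne hj]
    exact ofRealVec_mem_Strip hκ hp j

/-- the shifted multiplier `p ↦ G(p + iσe_i)` is continuous on the real zone. [folklore] -/
theorem continuousOn_imShift {G : (Fin (d + 1) → ℂ) → ℂ} {κ M σ : ℝ} (h : StripRegular G κ M) (hσ : |σ| ≤ κ)
    (i : Fin (d + 1)) :
    ContinuousOn (fun p : Fin (d + 1) → ℝ => G (Function.update (ofRealVec p) i ((ofRealVec p) i + σ * I))) (BZ (d + 1)) := by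
  have hc : Continuous fun p : Fin (d + 1) → ℝ => Function.update (ofRealVec p) i ((ofRealVec p) i + σ * I) := by
    refine continuous_pi fun j => ?_
    by_cases hj : j = i
    · subst hj
      simp only [Function.update_self]
      exact ((Complex.continuous_ofReal.comp (continuous_apply j))).add continuous_const
    · simp only [Function.update_of_ne hj]
      exact Complex.continuous_ofReal.comp (continuous_apply j)
  refine h.cont.comp hc.continuousOn fun p hp => ?_
  exact update_ofRealVec_mem_Strip hσ i hp

/-- the shifted multiplier has an integrable lattice-kernel integrand. [folklore] -/
theorem integrableOn_integrand_imShift {G : (Fin (d + 1) → ℂ) → ℂ} {κ M σ : ℝ} (h : StripRegular G κ M) (hσ : |σ| ≤ κ)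
    (i : Fin (d + 1)) (x : Fin (d + 1) → ℤ) :
    IntegrableOn (integrand (fun p => G (Function.update p i (p i + σ * I))) x) (BZ (d + 1)) :=
  integrableOn_integrand_of_continuousOn (continuousOn_imShift h hσ i) x

/-- **THE CONTOUR-SHIFT IDENTITY IN ONE COORDINATE** (box form): for a strip-regular multiplier `G` (half-width `κ`, any bound) and
`|σ| ≤ κ`, `∫_{[−π,π]^{d+1}} G(p + iσe_i)e^{ip·x}dp = e^{σx_i}·∫_{[−π,π]^{d+1}} G(p)e^{ip·x}dp` — Cauchy–Goursat on the rectangle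
`[−π,π] × [0,σ]` in the `i`-th coordinate (`B4ContourShift.integral_shift`), the vertical sides cancelling by `2π`-periodicity, slice by slice
under Fubini (`fourierBox_eq_iterated`). [folklore] -/
theorem fourierBox_imShift {G : (Fin (d + 1) → ℂ) → ℂ} {κ M σ : ℝ} (h : StripRegular G κ M) (hσ : |σ| ≤ κ)
    (i : Fin (d + 1)) (x : Fin (d + 1) → ℤ) :
    fourierBox (fun p => G (Function.update p i (p i + σ * I))) x = cexp (σ * x i) * fourierBox G x := by
  have hκ : 0 ≤ κ := (abs_nonneg σ).trans hσ
  have hint := h.integrableOn hκ x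
  have hint' := integrableOn_integrand_imShift h hσ i x
  rw [fourierBox_eq_iterated _ x i hint', fourierBox_eq_iterated G x i hint, ← integral_const_mul]
  refine setIntegral_congr_fun (by unfold BZ; exact measurableSet_Icc) fun q hq => ?_
  -- the slice data at `q`
  obtain ⟨hc, hdiff, hside, _⟩ := h.sliceRegular hκ i q hq
  set C : ℂ := cexp (I * phase q (fun j => x (i.succAbove j))) with hC
  -- the slice integrand `g(z) = G(insertNth z q)·C·e^{izx_i}`
  set g : ℂ → ℂ := fun z => G (i.insertNth z (ofRealVec q)) * C * cexp (I * z * (x i)) with hg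
  have hI : (∫ t in Icc (-π) π, integrand G x (i.insertNth t q)) = ∫ t in (-π)..π, g t := by
    rw [intervalIntegral.integral_of_le (by linarith [Real.pi_pos] : -π ≤ π), integral_Icc_eq_integral_Ioc]
    refine setIntegral_congr_fun measurableSet_Ioc fun t _ => ?_
    simp only [integrand, hg, ofRealVec_insertNth, phase_insertNth, mul_add, Complex.exp_add, hC]
    ring
  have hI' : (∫ t in Icc (-π) π, integrand (fun p => G (Function.update p i (p i + σ * I))) x (i.insertNth t q))
      = ∫ t in (-π)..π, g (t + σ * I) * cexp (σ * x i) := by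
    rw [intervalIntegral.integral_of_le (by linarith [Real.pi_pos] : -π ≤ π), integral_Icc_eq_integral_Ioc]
    refine setIntegral_congr_fun measurableSet_Ioc fun t _ => ?_
    simp only [integrand, hg, ofRealVec_insertNth, phase_insertNth, mul_add, Complex.exp_add, hC, Fin.insertNth_apply_same,
      Fin.update_insertNth]
    have e : cexp (I * (↑t + ↑σ * I) * ↑(x i)) * cexp (↑σ * ↑(x i)) = cexp (I * ↑t * ↑(x i)) := by
      rw [← Complex.exp_add]
      congr 1
      have : I * I = -1 := Complex.I_mul_I
      linear_combination (↑σ * ↑(x i)) * this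
    calc G (i.insertNth (↑t + ↑σ * I) (ofRealVec q)) * (cexp (I * (↑t * ↑(x i))) * cexp (I * phase q fun j => x (i.succAbove j)))
        = G (i.insertNth (↑t + ↑σ * I) (ofRealVec q)) * cexp (I * phase q fun j => x (i.succAbove j))
            * (cexp (I * (↑t + ↑σ * I) * ↑(x i)) * cexp (↑σ * ↑(x i))) := by rw [e]; ring
      _ = _ := by ring
  -- the contour shift for `g`
  have hc' : ContinuousOn g (closedRect κ) :=
    (hc.mul continuousOn_const).mul (Continuous.continuousOn (by fun_prop))
  have hd' : DifferentiableOn ℂ g (openRect κ) :=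
    (hdiff.mul (differentiableOn_const _)).mul (Differentiable.differentiableOn (by fun_prop))
  have hside' : ∀ y : ℝ, |y| ≤ κ → g (-π + y * I) = g (π + y * I) := by
    intro y hy
    simp only [hg]
    rw [hside y hy, side_char (x i) y]
  have shift := integral_shift g hσ hc' hd' hside'
  rw [hI', hI, shift, intervalIntegral.integral_mul_const, mul_comm]

/-- **THE CONTOUR-SHIFT IDENTITY FOR THE LATTICE KERNEL**: `K_{G(·+iσe_i)}(x) = e^{σx_i}·K_G(x)`. [folklore] -/
theorem latticeKernel_imShift {G : (Fin (d + 1) → ℂ) → ℂ} {κ M σ : ℝ} (h : StripRegular G κ M) (hσ : |σ| ≤ κ)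
    (i : Fin (d + 1)) (x : Fin (d + 1) → ℤ) :
    latticeKernel (fun p => G (Function.update p i (p i + σ * I))) x = cexp (σ * x i) * latticeKernel G x := by
  unfold latticeKernel
  rw [fourierBox_imShift h hσ i x, Complex.real_smul, Complex.real_smul]
  ring

/-- modulus form: `‖K_{G(·+iσe_i)}(x)‖ = e^{σx_i}·‖K_G(x)‖`, hence `‖K_{G(·+iσe_i)}(x)‖² = ‖K_G(x)‖²·e^{2σx_i}`. [folklore] -/
theorem normSq_latticeKernel_imShift {G : (Fin (d + 1) → ℂ) → ℂ} {κ M σ : ℝ} (h : StripRegular G κ M) (hσ : |σ| ≤ κ)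
    (i : Fin (d + 1)) (x : Fin (d + 1) → ℤ) :
    ‖latticeKernel (fun p => G (Function.update p i (p i + σ * I))) x‖ ^ 2
      = ‖latticeKernel G x‖ ^ 2 * Real.exp (2 * σ * x i) := by
  rw [latticeKernel_imShift h hσ i x, norm_mul]
  have : ‖cexp (↑σ * ↑(x i))‖ = Real.exp (σ * x i) := by
    rw [Complex.norm_exp]
    simp
  rw [this, mul_pow, ← Real.exp_nat_mul]
  ring_nf

/-! ## §2. Weighted Bessel on the shifted contour -/

/-- **WEIGHTED BESSEL, INTEGRAL DISPLAYED**: `Σ_{x∈T}‖K_G(x)‖²e^{2σx_i} ≤ (2π)^{−(d+1)}∫_{[−π,π]^{d+1}}‖G(p + iσe_i)‖²dp` for every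
finite window `T` — Paley–Wiener's weighted `ℓ²` norm IS the shifted-contour `L²` norm (Bessel half; `I_i(σ)` of T-109 §4.1). [folklore] -/
theorem sum_normSq_latticeKernel_exp_le_integral {G : (Fin (d + 1) → ℂ) → ℂ} {κ M σ : ℝ} (h : StripRegular G κ M)
    (hσ : |σ| ≤ κ) (i : Fin (d + 1)) (T : Finset (Fin (d + 1) → ℤ)) :
    ∑ x ∈ T, ‖latticeKernel G x‖ ^ 2 * Real.exp (2 * σ * x i)
      ≤ ((2 * π) ^ (d + 1))⁻¹
        * ∫ p in BZ (d + 1), ‖G (Function.update (ofRealVec p) i ((ofRealVec p) i + σ * I))‖ ^ 2 := by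
  have hB := sum_normSq_latticeKernel_le (Gm := fun p => G (Function.update p i (p i + σ * I)))
    (continuousOn_imShift h hσ i) T
  simp_rw [normSq_latticeKernel_imShift h hσ i] at hB
  exact hB

/-- **WEIGHTED BESSEL, BOUND FORM**: `Σ_{x∈T}‖K_G(x)‖²e^{2σx_i} ≤ M²` (`|G| ≤ M` on the strip, the zone has volume `(2π)^{d+1}`). [folklore] -/
theorem sum_normSq_latticeKernel_exp_le {G : (Fin (d + 1) → ℂ) → ℂ} {κ M σ : ℝ} (h : StripRegular G κ M)
    (hσ : |σ| ≤ κ) (i : Fin (d + 1)) (T : Finset (Fin (d + 1) → ℤ)) :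
    ∑ x ∈ T, ‖latticeKernel G x‖ ^ 2 * Real.exp (2 * σ * x i) ≤ M ^ 2 := by
  refine (sum_normSq_latticeKernel_exp_le_integral h hσ i T).trans ?_
  have hvol : volume (BZ (d + 1)) < ⊤ := by unfold BZ; exact measure_Icc_lt_top
  have hbd : ∀ p ∈ BZ (d + 1), ‖(‖G (Function.update (ofRealVec p) i ((ofRealVec p) i + σ * I))‖ ^ 2 : ℝ)‖ ≤ M ^ 2 := by
    intro p hp
    rw [Real.norm_eq_abs, abs_of_nonneg (sq_nonneg _)]
    have hM := h.bound _ (update_ofRealVec_mem_Strip hσ i hp)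
    exact pow_le_pow_left₀ (norm_nonneg _) hM 2
  have h1 := norm_setIntegral_le_of_norm_le_const hvol hbd
  have hreal : volume.real (BZ (d + 1)) = (2 * π) ^ (d + 1) := by
    rw [measureReal_def, BZ, Real.volume_Icc_pi_toReal]
    · simp only [sub_neg_eq_add, Finset.prod_const, Finset.card_univ, Fintype.card_fin]; ring
    · intro j; simp only; linarith [Real.pi_pos]
  rw [hreal] at h1
  have hpos : (0 : ℝ) < (2 * π) ^ (d + 1) := by positivity
  have h2 : ∫ p in BZ (d + 1), ‖G (Function.update (ofRealVec p) i ((ofRealVec p) i + σ * I))‖ ^ 2 ≤ M ^ 2 * (2 * π) ^ (d + 1) :=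
    (Real.le_norm_self _).trans h1
  calc ((2 * π) ^ (d + 1))⁻¹ * ∫ p in BZ (d + 1), ‖G (Function.update (ofRealVec p) i ((ofRealVec p) i + σ * I))‖ ^ 2
      ≤ ((2 * π) ^ (d + 1))⁻¹ * (M ^ 2 * (2 * π) ^ (d + 1)) := mul_le_mul_of_nonneg_left h2 (inv_pos.mpr hpos).le
    _ = M ^ 2 := by field_simp

/-! ## §3. The sup-norm weight -/

/-- `e^{2q|x|_∞} ≤ Σ_i (e^{2qx_i} + e^{−2qx_i})` (the sup norm is attained at some coordinate). [folklore] -/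
theorem exp_mul_supNorm_le_sum (q : ℝ) (x : Fin (d + 1) → ℤ) :
    Real.exp (2 * q * supNorm x) ≤ ∑ i, (Real.exp (2 * q * x i) + Real.exp (-(2 * q * x i))) := by
  obtain ⟨i, hi⟩ := exists_supNorm_eq x
  have hterm : ∀ j, 0 ≤ Real.exp (2 * q * x j) + Real.exp (-(2 * q * x j)) := fun j => by positivity
  refine le_trans ?_ (Finset.single_le_sum (fun j _ => hterm j) (Finset.mem_univ i))
  rw [hi]
  rcases le_total 0 (x i) with hx | hx
  · have : ((|x i| : ℤ) : ℝ) = (x i : ℝ) := by exact_mod_cast abs_of_nonneg hx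
    rw [this]
    linarith [Real.exp_pos (-(2 * q * (x i : ℝ)))]
  · have : ((|x i| : ℤ) : ℝ) = -(x i : ℝ) := by exact_mod_cast abs_of_nonpos hx
    rw [this, show 2 * q * -(x i : ℝ) = -(2 * q * x i) by ring]
    linarith [Real.exp_pos (2 * q * (x i : ℝ))]

/-- **THE SUP-WEIGHTED `ℓ²` LETTER**: `W_T(q)² = Σ_{x∈T}‖K_G(x)‖²e^{2q|x|_∞} ≤ 2(d+1)·M²` for `0 ≤ q ≤ κ` (sum of the `2(d+1)`
one-coordinate letters of §2 at `σ = ±q`). [folklore] -/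
theorem sum_normSq_latticeKernel_expSup_le {G : (Fin (d + 1) → ℂ) → ℂ} {κ M q : ℝ} (h : StripRegular G κ M)
    (hq0 : 0 ≤ q) (hqκ : q ≤ κ) (T : Finset (Fin (d + 1) → ℤ)) :
    ∑ x ∈ T, ‖latticeKernel G x‖ ^ 2 * Real.exp (2 * q * supNorm x) ≤ 2 * (d + 1) * M ^ 2 := by
  have hq : |q| ≤ κ := by rwa [abs_of_nonneg hq0]
  have hq' : |-q| ≤ κ := by rwa [abs_neg]
  calc ∑ x ∈ T, ‖latticeKernel G x‖ ^ 2 * Real.exp (2 * q * supNorm x)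
      ≤ ∑ x ∈ T, ‖latticeKernel G x‖ ^ 2 * ∑ i, (Real.exp (2 * q * x i) + Real.exp (-(2 * q * x i))) :=
        Finset.sum_le_sum fun x _ => mul_le_mul_of_nonneg_left (exp_mul_supNorm_le_sum q x) (sq_nonneg _)
    _ = ∑ i, (∑ x ∈ T, ‖latticeKernel G x‖ ^ 2 * Real.exp (2 * q * x i)
          + ∑ x ∈ T, ‖latticeKernel G x‖ ^ 2 * Real.exp (2 * (-q) * x i)) := by
        simp_rw [Finset.mul_sum]
        rw [Finset.sum_comm]
        refine Finset.sum_congr rfl fun i _ => ?_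
        rw [← Finset.sum_add_distrib]
        refine Finset.sum_congr rfl fun x _ => ?_
        rw [mul_add, show 2 * (-q) * (x i : ℝ) = -(2 * q * x i) by ring]
    _ ≤ ∑ _i : Fin (d + 1), (M ^ 2 + M ^ 2) := Finset.sum_le_sum fun i _ =>
        add_le_add (sum_normSq_latticeKernel_exp_le h hq i T) (sum_normSq_latticeKernel_exp_le h hq' i T)
    _ = 2 * (d + 1) * M ^ 2 := by
        rw [Finset.sum_const, Finset.card_univ, Fintype.card_fin, nsmul_eq_mul]; push_cast; ring

/-! ## §4. The Cauchy–Schwarz tail -/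

/-- **CAUCHY–SCHWARZ TAIL**: `Σ_{x∈S}‖K(x)‖ ≤ √(Σ_{x∈S}e^{−2q|x|_∞})·√(Σ_{x∈S}‖K(x)‖²e^{2q|x|_∞})` for every finite `S` and real `q`
(write `‖K‖ = e^{−q|x|_∞}·(‖K‖e^{q|x|_∞})`). [folklore] -/
theorem sum_norm_le_sqrt_mul_sqrt (K : (Fin (d + 1) → ℤ) → ℂ) (q : ℝ) (S : Finset (Fin (d + 1) → ℤ)) :
    ∑ x ∈ S, ‖K x‖ ≤ Real.sqrt (∑ x ∈ S, Real.exp (-(2 * q * supNorm x)))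
      * Real.sqrt (∑ x ∈ S, ‖K x‖ ^ 2 * Real.exp (2 * q * supNorm x)) := by
  have hfg : ∀ x : Fin (d + 1) → ℤ,
      ‖K x‖ = Real.exp (-(q * supNorm x)) * (‖K x‖ * Real.exp (q * supNorm x)) := fun x => by
    rw [mul_left_comm, ← Real.exp_add, neg_add_cancel, Real.exp_zero, mul_one]
  have hf2 : ∀ x : Fin (d + 1) → ℤ, Real.exp (-(q * supNorm x)) ^ 2 = Real.exp (-(2 * q * supNorm x)) := fun x => by
    rw [← Real.exp_nat_mul]; ring_nf
  have hg2 : ∀ x : Fin (d + 1) → ℤ,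
      (‖K x‖ * Real.exp (q * supNorm x)) ^ 2 = ‖K x‖ ^ 2 * Real.exp (2 * q * supNorm x) := fun x => by
    rw [mul_pow, ← Real.exp_nat_mul]; ring_nf
  have hcs := Finset.sum_mul_sq_le_sq_mul_sq S (fun x => Real.exp (-(q * supNorm x)))
    (fun x => ‖K x‖ * Real.exp (q * supNorm x))
  simp only [hf2, hg2] at hcs
  have h0 : 0 ≤ ∑ x ∈ S, Real.exp (-(q * supNorm x)) * (‖K x‖ * Real.exp (q * supNorm x)) :=
    Finset.sum_nonneg fun x _ => by positivity
  have hlhs : ∑ x ∈ S, ‖K x‖ = ∑ x ∈ S, Real.exp (-(q * supNorm x)) * (‖K x‖ * Real.exp (q * supNorm x)) :=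
    Finset.sum_congr rfl fun x _ => hfg x
  rw [hlhs, ← Real.sqrt_mul (Finset.sum_nonneg fun _ _ => (Real.exp_pos _).le), ← Real.sqrt_sq h0]
  exact Real.sqrt_le_sqrt hcs

/-! ## §5. The parametric `ℓ¹`-row letter -/

/-- **THE PARAMETRIC ROW LETTER (near field + Cauchy–Schwarz tail)**: for every finite window `T`, every radius `r₀` and every real `q`,
`Σ_{x∈T}‖K(x)‖ ≤ Σ_{x∈T,|x|_∞≤r₀}‖K(x)‖ + √(Σ_{x∈T,|x|_∞>r₀}e^{−2q|x|_∞})·√(Σ_{x∈T,|x|_∞>r₀}‖K(x)‖²e^{2q|x|_∞})` — T-109 §4.1's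
`NF(r₀) + TAIL(r₀, q)` with both factors DISPLAYED (valid for ANY kernel `K`; nothing analytic yet). [folklore] -/
theorem row_letter_parametric (K : (Fin (d + 1) → ℤ) → ℂ) (q r₀ : ℝ) (T : Finset (Fin (d + 1) → ℤ)) :
    ∑ x ∈ T, ‖K x‖ ≤ ∑ x ∈ T.filter (fun x => supNorm x ≤ r₀), ‖K x‖
      + Real.sqrt (∑ x ∈ T.filter (fun x => ¬ supNorm x ≤ r₀), Real.exp (-(2 * q * supNorm x)))
        * Real.sqrt (∑ x ∈ T.filter (fun x => ¬ supNorm x ≤ r₀), ‖K x‖ ^ 2 * Real.exp (2 * q * supNorm x)) := by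
  rw [← Finset.sum_filter_add_sum_filter_not T (fun x => supNorm x ≤ r₀)]
  exact add_le_add le_rfl (sum_norm_le_sqrt_mul_sqrt K q _)

/-- **THE ROW LETTER OF A STRIP-REGULAR MULTIPLIER**: for `StripRegular G κ M`, `0 ≤ q ≤ κ`, every finite window `T` and radius `r₀`,
`Σ_{x∈T}‖K_G(x)‖ ≤ NF_T(r₀) + √(Σ_{x∈T,|x|_∞>r₀}e^{−2q|x|_∞})·√(2(d+1))·M` — (CT-2) of Road B BY NAME; the near field `NF_T(r₀)` (finitely
many kernel values, (CT-3)) and the tail count (a lattice sum) are displayed, `M` and `q ≤ κ` come from (CT-1). [folklore] -/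
theorem row_letter {G : (Fin (d + 1) → ℂ) → ℂ} {κ M q : ℝ} (h : StripRegular G κ M) (hM : 0 ≤ M) (hq0 : 0 ≤ q) (hqκ : q ≤ κ)
    (r₀ : ℝ) (T : Finset (Fin (d + 1) → ℤ)) :
    ∑ x ∈ T, ‖latticeKernel G x‖ ≤ ∑ x ∈ T.filter (fun x => supNorm x ≤ r₀), ‖latticeKernel G x‖
      + Real.sqrt (∑ x ∈ T.filter (fun x => ¬ supNorm x ≤ r₀), Real.exp (-(2 * q * supNorm x)))
        * (Real.sqrt (2 * (d + 1)) * M) := by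
  refine (row_letter_parametric (latticeKernel G) q r₀ T).trans (add_le_add le_rfl ?_)
  refine mul_le_mul_of_nonneg_left ?_ (Real.sqrt_nonneg _)
  have hW := sum_normSq_latticeKernel_expSup_le h hq0 hqκ (T.filter (fun x => ¬ supNorm x ≤ r₀))
  calc Real.sqrt (∑ x ∈ T.filter (fun x => ¬ supNorm x ≤ r₀), ‖latticeKernel G x‖ ^ 2 * Real.exp (2 * q * supNorm x))
      ≤ Real.sqrt (2 * (d + 1) * M ^ 2) := Real.sqrt_le_sqrt hW
    _ = Real.sqrt (2 * (d + 1)) * M := by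
        rw [Real.sqrt_mul (by positivity), Real.sqrt_sq hM]

end Summit.QuantumFields.BalabanUV.T4Continuum.NE7b.OneShotChartPaleyWiener
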